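import Summits.Ventures.PercRepro.SixFourPLTypes

/-!
# PercRepro — C-025 at `(6,4)`, §22.12.4: the TYPE of a plane of `M` and its cost and lpp credit (p3, gen 10)

`SixFourPLTypes.lean` introduced the type `PL.ty Q` of a list entry — size and numbers of lines with `3, …, 7`
points — and showed that `cost5` and the lpp credit of an entry depend only on it.  This file does the same for the
planes of `M`: `tyP M G P` records `|P ∩ G|` and the numbers `inc M (P ∩ G) m` of lines of `M` meeting the trace in
`m = 3, …, 7` points, and for a plane whose trace has rank `3` and at most `7` points
* `cost5_tyP`: `cost5 g (tyP P) = 5·cost_g(P)` (`D₃` and `r₃₄` of the trace in profile form, `D3_add_profile` /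
  `r34_add_profile` from `D3_add_sum_delta` and `card_rank_two_subsets`);
* `credit_tyP`: `credit (tyP P) = lppCredit P` (`sum_eps_eq_lppProf`).
So both sides of 22.12.4 (1) and (3) are sums of ONE function of the type — over the planes of `M` on the left and
over the list with multiplicities on the right; `SixFourPLKinds.lean` compares the two sums.
-/

namespace PercRepro.SixFour

open Finset ThmH

variable {α : Type*} [DecidableEq α] {M : Matroid α} [M.Finite] {G : Finset α}

/-! ## The type of a plane of `M` -/

/-- The TYPE of a plane `P` of `M` on `G`: `|P ∩ G|` and the numbers of lines of `M` meeting `P ∩ G` in `3, …, 7`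
points. -/
noncomputable def tyP (M : Matroid α) [M.Finite] (G P : Finset α) : PL.Pl :=
  ⟨(P ∩ G).card, (List.range 5).map fun i => (i + 3, inc M (P ∩ G) (i + 3)), 1⟩

/-- The size of `tyP`. -/
theorem tyP_q (P : Finset α) : (tyP M G P).q = (P ∩ G).card := rfl

/-- The line counts of `tyP` for `3 ≤ m ≤ 7`. -/
theorem Lcount_tyP (P : Finset α) (m : ℕ) (h3 : 3 ≤ m) (h7 : m ≤ 7) : PL.Lcount (tyP M G P) m = inc M (P ∩ G) m := by
  unfold tyP
  rw [PL.Lcount_eq_LcountL]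
  simp only [List.range_succ, List.range_zero, List.map_cons, List.map_nil, List.nil_append, List.cons_append,
    PL.LcountL_cons, PL.LcountL_nil]
  interval_cases m <;> simp

/-- `tyP` is small. -/
theorem Small_tyP (P : Finset α) : PL.Small (tyP M G P) := by
  intro mc hmc _
  unfold tyP at hmc
  simp only [List.mem_map, List.mem_range] at hmc
  obtain ⟨i, hi, rfl⟩ := hmc
  dsimp only
  omega

/-- `D₃(P) + (inc₄ + 6·inc₅ + 22·inc₆) = δ(p)` for a rank-`3` trace with `≤ 7` points. -/
theorem D3_add_profile (hs : Simple M) (hG : G ⊆ gr M) {P : Finset α} (h7 : (P ∩ G).card ≤ 7)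
    (hr : M.eRk ((P ∩ G : Finset α) : Set α) = 3) :
    D3 M G P + (inc M (P ∩ G) 4 + 6 * inc M (P ∩ G) 5 + 22 * inc M (P ∩ G) 6) = delta (P ∩ G).card := by
  set ρ := P ∩ G with hρdef
  have hρ : ρ ⊆ gr M := Finset.inter_subset_right.trans hG
  obtain ⟨d0, d1, d2, d3, d4, d5, d6⟩ := delta_values
  have hD := D3_add_sum_delta hs hρ hr
  have eD := sum_lines_eq_sum_inc (M := M) ρ (fun n => delta n)
  rw [eD, sum_inc_range_eight hr h7] at hD
  have hi7 : inc M ρ 7 = 0 := inc_eq_zero_of_card_le hr (by omega)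
  simp only [Finset.sum_range_succ, Finset.sum_range_zero, d0, d1, d2, d3, d4, d5, d6, hi7, mul_zero, zero_add,
    mul_one, zero_mul, add_zero] at hD
  show (ρ.powerset.filter (fun S : Finset α => 4 ≤ S.card ∧ M.eRk (S : Set α) = 3)).card + _ = _
  omega

/-- `r₃₄(P) + (inc₄ + 5·inc₅ + 15·inc₆) = C(p,4)` for a rank-`3` trace with `≤ 7` points. -/
theorem r34_add_profile (hs : Simple M) (hG : G ⊆ gr M) {P : Finset α} (h7 : (P ∩ G).card ≤ 7)
    (hr : M.eRk ((P ∩ G : Finset α) : Set α) = 3) :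
    r34 M G P + (inc M (P ∩ G) 4 + 5 * inc M (P ∩ G) 5 + 15 * inc M (P ∩ G) 6) = (P ∩ G).card.choose 4 := by
  set ρ := P ∩ G with hρdef
  have hρ : ρ ⊆ gr M := Finset.inter_subset_right.trans hG
  have hsplit := Finset.card_filter_add_card_filter_not (s := ρ.powersetCard 4)
    (fun Z : Finset α => M.eRk (Z : Set α) = 3)
  have hcongr : (ρ.powersetCard 4).filter (fun Z : Finset α => ¬ M.eRk (Z : Set α) = 3) =
      (ρ.powersetCard 4).filter (fun Z : Finset α => M.eRk (Z : Set α) = 2) := by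
    refine Finset.filter_congr (fun Z hZ => ?_)
    obtain ⟨hZρ, hc⟩ := Finset.mem_powersetCard.1 hZ
    have hle : M.eRk (Z : Set α) ≤ 3 := by rw [← hr]; exact M.eRk_mono (Finset.coe_subset.2 hZρ)
    constructor
    · intro hne
      refine le_antisymm ?_ (two_le_eRk_of_two_le_card hs hρ hZρ (by omega))
      by_contra h
      exact hne (eRk_eq_of_le_of_not_le (n := 2) hle h)
    · intro h2; rw [h2]; decide
  rw [hcongr, card_rank_two_subsets hs hρ (by norm_num : 2 ≤ 4), Finset.card_powersetCard] at hsplit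
  have e4 := sum_lines_eq_sum_inc (M := M) ρ (fun n => n.choose 4)
  rw [e4, sum_inc_range_eight hr h7] at hsplit
  have hi7 : inc M ρ 7 = 0 := inc_eq_zero_of_card_le hr (by omega)
  have hc : Nat.choose 0 4 = 0 ∧ Nat.choose 1 4 = 0 ∧ Nat.choose 2 4 = 0 ∧ Nat.choose 3 4 = 0 ∧ Nat.choose 4 4 = 1 ∧
      Nat.choose 5 4 = 5 ∧ Nat.choose 6 4 = 15 := by decide
  obtain ⟨c0, c1, c2, c3, c4, c5, c6⟩ := hc
  simp only [Finset.sum_range_succ, Finset.sum_range_zero, c0, c1, c2, c3, c4, c5, c6, hi7, mul_zero, zero_add,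
    mul_one, zero_mul, add_zero] at hsplit
  show (((ρ.powersetCard 4).filter (fun S : Finset α => M.eRk (S : Set α) = 3)).card) + _ = _
  omega

/-- **`cost5 g (tyP P) = 5·cost_g(P)`** for a rank-`3` trace with `≤ 7` points (`g = |G|`). -/
theorem cost5_tyP (hs : Simple M) (hG : G ⊆ gr M) {P : Finset α} (h7 : (P ∩ G).card ≤ 7)
    (hr : M.eRk ((P ∩ G : Finset α) : Set α) = 3) :
    (PL.cost5 G.card (tyP M G P) : ℚ) = 5 * cost M G P := by
  have hD := D3_add_profile hs hG h7 hr
  have hR := r34_add_profile hs hG h7 hr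
  have hi7 : inc M (P ∩ G) 7 = 0 := inc_eq_zero_of_card_le hr (by omega)
  have hD' : (D3 M G P : ℚ) = (delta (P ∩ G).card : ℚ) -
      (inc M (P ∩ G) 4 + 6 * inc M (P ∩ G) 5 + 22 * inc M (P ∩ G) 6 : ℚ) := by
    have := congrArg (fun n : ℕ => (n : ℚ)) hD
    push_cast at this
    linarith
  have hR' : (r34 M G P : ℚ) = ((P ∩ G).card.choose 4 : ℚ) -
      (inc M (P ∩ G) 4 + 5 * inc M (P ∩ G) 5 + 15 * inc M (P ∩ G) 6 : ℚ) := by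
    have := congrArg (fun n : ℕ => (n : ℚ)) hR
    push_cast at this
    linarith
  unfold PL.cost5 PL.D3 PL.r34 tyP cost
  simp only [List.range_succ, List.range_zero, List.map_cons, List.map_nil, List.sum_cons, List.sum_nil,
    List.nil_append, List.cons_append, PLdelta_eq, PLch_eq_choose, hi7]
  obtain ⟨d0, d1, d2, d3, d4, d5, d6⟩ := delta_values
  have hc : Nat.choose 3 4 = 0 ∧ Nat.choose 4 4 = 1 ∧ Nat.choose 5 4 = 5 ∧ Nat.choose 6 4 = 15 := by decide
  obtain ⟨c3, c4, c5, c6⟩ := hc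
  simp only [d3, d4, d5, d6, c3, c4, c5, c6]
  push_cast
  rw [hD', hR']
  ring

/-- **`credit (tyP P) = lppCredit P`** for a rank-`3` trace with `≤ 7` points. -/
theorem credit_tyP {P : Finset α} (h7 : (P ∩ G).card ≤ 7)
    (hr : M.eRk ((P ∩ G : Finset α) : Set α) = 3) :
    PL.credit (tyP M G P) = (lppCredit M G P : ℤ) := by
  have hi7 : inc M (P ∩ G) 7 = 0 := inc_eq_zero_of_card_le hr (by omega)
  have hl : lppCredit M G P = lppProf (P ∩ G).card (inc M (P ∩ G) 3) (inc M (P ∩ G) 4) (inc M (P ∩ G) 5)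
      (inc M (P ∩ G) 6) := sum_eps_eq_lppProf hr h7
  rw [hl]
  unfold PL.credit lppProf
  simp only [List.range_succ, List.range_zero, List.map_cons, List.map_nil, List.sum_cons, List.sum_nil,
    List.nil_append, List.cons_append, tyP_q]
  rw [Lcount_tyP P 3 (by norm_num) (by norm_num), Lcount_tyP P 4 (by norm_num) (by norm_num),
    Lcount_tyP P 5 (by norm_num) (by norm_num), Lcount_tyP P 6 (by norm_num) (by norm_num),
    Lcount_tyP P 7 (by norm_num) (by norm_num), hi7]
  have he : ∀ m, (PL.eps m : ℤ) = (eps m : ℤ) := fun m => by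
    unfold PL.eps eps
    rw [PLch_eq_choose]
    omega
  simp only [he, PLch_eq_choose]
  push_cast
  ring

end PercRepro.SixFour
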